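import Summits.HodgeConjecture.HodgeConjecture.Theorems.Ring2WeilCoverageCMFieldRationalClassesCyclicFibres
import Mathlib.FieldTheory.Finite.Basic
import HarnessLib

/-!
# Ring 2 — Weil-family coverage, CM-field rows: the two places over a split prime, LABELLED BY THE ROOTS of `R̄`, and the
  square class of `θ` at each — fibre constancy ⟺ `(q|ℓ) = 1` (WEIL-FAMILY-COVERAGE «## b03», cell (xxi⁹), part 53)

research route conditional on HC_CM; not a corollary; Q11.4-sentence-2 already refuted in dim ≥ 3.

On a quadratic carrier `R = S² + pS + q` (`F = ℚ(θ)`, `E = F(√θ)`, rows labelled by `T(t) = {𝔭 : (t, θ)_𝔭 = -1}`)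
[cite: Deligne1982HodgeCycles, §4 (1), Cor. 4.2], parts 33/46 proved FIBRE CONSTANCY of the rational classes over the
split primes for the twenty Galois fields, from `q = θθ'` being a square in `𝓞_F`.  This file isolates the mechanism
for EVERY quadratic carrier and every odd prime `ℓ ∤ q(p² - 4q)` at which `p² - 4q` is a square:

* §151 **THE LABELLED FIBRE**: there are an integer root `r` of `R` mod `ℓ` and two places `v ≠ v'` over `ℓ`, of norm `ℓ`
  and with `ord ℓ = 1`, such that `θ ≡ r (mod v)` and `θ ≡ -p - r (mod v')` (the OTHER root), every place over `ℓ`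
  being `v` or `v'` (part 14's degree-one place `(ℓ, θ - r)` with `ℓ ∥ R(r)`; `θ - r ∉ v'` since `θ - r ∈ (ℓ)` would give
  `ℓ² ∣ N(θ - r) = R(r)`);
* §152 **THE SQUARE CLASS OF `θ` ON THE FIBRE**: `v ∈ T(ℓ) ⟺ r` is a non-square mod `ℓ`, `v' ∈ T(ℓ) ⟺ -p - r` is a
  non-square mod `ℓ` (63:11a/63:12), and `r(-p - r) ≡ q`; hence **`v ∈ T(ℓ) ⟺ v' ∈ T(ℓ)` when `(q|ℓ) = 1`** (fibre
  constancy — all fifteen biquadratic carriers have `q` a perfect square, the cyclic ones `q ∈ d·ℤ²` with `(d|ℓ) = 1` at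
  split `ℓ`) and **`v ∈ T(ℓ) ⟺ v' ∉ T(ℓ)` when `(q|ℓ) = -1`** («LONELY» primes: exactly one of the two places is bad —
  the non-Galois table `ℚ(√-(3+√2))`, `q = 7`, part 54) [cite: Omeara1963, §63B Cor. 63:11a and Example 63:12];
* §153 **INERT PRIMES, converse of part 21**: at a place over an odd prime `ℓ ∤ q` with `p² - 4q` a NON-square and `q` a
  SQUARE mod `ℓ`, `θ` is a square mod `v` (`θ̄^{ℓ+1} = q̄ = w²` and Euler's criterion in `𝔽_{ℓ²}`), so `v ∉ T(ℓ)`: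
  together with part 47, **`(ℓ) ∈ T(ℓ) ⟺ (q|ℓ) = -1`** at the inert primes.

No new definition, no named fact, no sorry; nothing about the Hodge conjecture is asserted.
-/

noncomputable section

set_option linter.dupNamespace false

open Polynomial NumberField IsDedekindDomain

namespace Summit.HodgeConjecture.HodgeConjecture.Ring2.WeilCoverageCM

open Literature.AlgebraicGeometry.Deligne1982
open Literature.AlgebraicGeometry.HodgeTheory (splitDiscriminantClassCM)
open Literature.NumberTheory.QuadraticForms

variable {R : Polynomial ℤ} [Fact (Irreducible (cmPolyQ R))] [Fact (Irreducible (realPolyQ R))]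

/-! ### §151 The two places over a split prime, labelled by the roots of `R̄` -/

omit [Fact (Irreducible (cmPolyQ R))] in
/-- **THE LABELLED FIBRE OVER A SPLIT PRIME.** `R = S² + pS + q`, `ℓ` an odd prime with `ℓ ∤ p² - 4q` and `p² - 4q` a square
mod `ℓ`. Then there are an integer `r` with `ℓ ∣ R(r)` and two places `v ≠ v'` of `F` over `ℓ`, both of norm `ℓ` with
`ord ℓ = 1`, such that `θ ≡ r (mod v)`, `θ ≡ -p-r (mod v')`, and every place over `ℓ` is `v` or `v'`. [folklore]
[cite: Omeara1963, §63B Example 63:12] -/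
theorem exists_labelled_places_of_isSquare_disc {p q : ℤ} (hR : R = X ^ 2 + C p * X + C q)
    {θₒ : 𝓞 (realField R)} (hθ : (θₒ : realField R) = AdjoinRoot.root (realPolyQ R)) {ℓ : ℕ} (hℓ : ℓ.Prime)
    (hℓ2 : ℓ ≠ 2) (hℓdisc : ¬ (ℓ : ℤ) ∣ p ^ 2 - 4 * q) (hdsq : IsSquare ((p ^ 2 - 4 * q : ℤ) : ZMod ℓ)) :
    ∃ (r : ℤ) (v v' : HeightOneSpectrum (𝓞 (realField R))), (ℓ : ℤ) ∣ r ^ 2 + p * r + q ∧ v ≠ v' ∧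
      (ℓ : 𝓞 (realField R)) ∈ v.asIdeal ∧ (ℓ : 𝓞 (realField R)) ∈ v'.asIdeal ∧
      θₒ - r ∈ v.asIdeal ∧ θₒ + r + p ∈ v'.asIdeal ∧
      Ideal.absNorm v.asIdeal = ℓ ∧ Ideal.absNorm v'.asIdeal = ℓ ∧
      v.intValuation (ℓ : 𝓞 (realField R)) = WithZero.exp (-1 : ℤ) ∧
      v'.intValuation (ℓ : 𝓞 (realField R)) = WithZero.exp (-1 : ℤ) ∧
      ∀ u : HeightOneSpectrum (𝓞 (realField R)), (ℓ : 𝓞 (realField R)) ∈ u.asIdeal → u = v ∨ u = v' := by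
  have hK := finrank_realField_quadratic hR
  have hrel := ringOfIntegers_root_rel_quadratic hR hθ
  have hℓZ : Prime (ℓ : ℤ) := Nat.prime_iff_prime_int.1 hℓ
  -- a root `r` of `R` mod `ℓ` with `ℓ ∥ R(r)` (part 14)
  obtain ⟨s₁, hs₁⟩ := hdsq
  obtain ⟨s, rfl⟩ := ZMod.intCast_surjective s₁
  have hsd : (ℓ : ℤ) ∣ s * s - (p ^ 2 - 4 * q) := by
    rw [← ZMod.intCast_zmod_eq_zero_iff_dvd]; push_cast; rw [← hs₁]; push_cast; ring
  obtain ⟨r, hrs, hR1, hR2⟩ := exists_root_mod_of_sq_sub_disc_dvd hℓ hℓ2 hℓdisc hsd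
  obtain ⟨m₁, hm₁⟩ := hR1
  have hm₁ℓ : ¬ (ℓ : ℤ) ∣ m₁ := fun h ↦ hR2 (by rw [hm₁, sq]; exact mul_dvd_mul_left _ h)
  have h2rp : ¬ (ℓ : ℤ) ∣ 2 * r + p := fun h ↦ hℓdisc (by
    have e : p ^ 2 - 4 * q = (2 * r + p) * (2 * r + p) - 4 * (r ^ 2 + p * r + q) := by ring
    rw [e, hm₁]
    exact dvd_sub (dvd_mul_of_dvd_left h _) (Dvd.dvd.mul_left (dvd_mul_right _ _) _))
  set x : 𝓞 (realField R) := θₒ - r with hx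
  set x' : 𝓞 (realField R) := -θₒ - r - p with hx'
  have hxx' : x * x' = ℓ * m₁ := by
    have e : ((ℓ : ℤ) : 𝓞 (realField R)) * (m₁ : 𝓞 (realField R)) = ((r ^ 2 + p * r + q : ℤ) : 𝓞 (realField R)) := by
      rw [hm₁]; push_cast; ring
    rw [hx, hx', show (ℓ : 𝓞 (realField R)) = ((ℓ : ℤ) : 𝓞 (realField R)) by push_cast; rfl, e]
    push_cast
    linear_combination (-1 : 𝓞 (realField R)) * hrel
  have hNx : (Algebra.norm ℤ x).natAbs = ℓ * m₁.natAbs := by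
    rw [hx, norm_int_root_sub_intCast hR hθ r, hm₁, Int.natAbs_mul, Int.natAbs_natCast]
  have hNx' : ¬ ((ℓ : ℤ) ^ 2) ∣ Algebra.norm ℤ x' := by
    rw [hx', norm_int_neg_root_sub_intCast_sub hR hθ r]; exact hR2
  have hm₁' : ¬ ℓ ∣ m₁.natAbs := fun h ↦ hm₁ℓ (Int.natCast_dvd.2 h)
  -- the degree-one place `v = (ℓ, x)`
  obtain ⟨v, hv, hNv, hℓv, hxv⟩ := exists_place_absNorm_eq_of_norm hK hℓ hxx' hNx' hNx hm₁'
  have hℓv' : ((ℓ : ℤ) : 𝓞 (realField R)) ∈ v.asIdeal := by push_cast; exact hℓv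
  have h2rpv : ((2 * r + p : ℤ) : 𝓞 (realField R)) ∉ v.asIdeal :=
    intCast_notMem_of_isCoprime v ((Prime.coprime_iff_not_dvd hℓZ).2 h2rp) hℓv'
  have hx'v : x' ∉ v.asIdeal := fun h ↦ h2rpv (by
    have e : ((2 * r + p : ℤ) : 𝓞 (realField R)) = -x - x' := by rw [hx, hx']; push_cast; ring
    rw [e]; exact v.asIdeal.sub_mem (v.asIdeal.neg_mem hxv) h)
  have hm₁v : (m₁ : 𝓞 (realField R)) ∉ v.asIdeal :=
    intCast_notMem_of_isCoprime v ((Prime.coprime_iff_not_dvd hℓZ).2 hm₁ℓ) hℓv'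
  have hord := intValuation_natCast_eq_exp_neg_one_of_place v hv hxx' hx'v hm₁v
  -- the second place `v'`: `(ℓ) = v·J`, `N J = ℓ`
  obtain ⟨J, hJ⟩ := Ideal.dvd_iff_le.2 ((Ideal.span_singleton_le_iff_mem _).2 hℓv)
  have hNJ : Ideal.absNorm J = ℓ := by
    have h := congrArg Ideal.absNorm hJ
    rw [absNorm_span_natCast, hK, map_mul, hNv] at h
    have h' : ℓ * Ideal.absNorm J = ℓ * ℓ := by rw [← h]; ring
    exact Nat.eq_of_mul_eq_mul_left hℓ.pos h'
  have hJprime : J.IsPrime := Ideal.isPrime_of_irreducible_absNorm (by rw [hNJ]; exact hℓ)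
  have hJne : J ≠ ⊥ := fun h ↦ hℓ.ne_zero (by rw [← hNJ, h, Ideal.absNorm_bot])
  set v' : HeightOneSpectrum (𝓞 (realField R)) := ⟨J, hJprime, hJne⟩ with hv'def
  have hℓw' : (ℓ : 𝓞 (realField R)) ∈ v'.asIdeal := by
    have hle : Ideal.span {(ℓ : 𝓞 (realField R))} ≤ J := by rw [hJ]; exact Ideal.mul_le_left
    exact hle (Ideal.mem_span_singleton_self _)
  have hunit : ¬ IsUnit v.asIdeal := fun hu ↦ v.isPrime.ne_top (Ideal.isUnit_iff.1 hu)
  have hvv' : v ≠ v' := by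
    intro h
    have hJv : J = v.asIdeal := (congrArg HeightOneSpectrum.asIdeal h).symm
    have hsq : Ideal.span {(ℓ : 𝓞 (realField R))} = v.asIdeal ^ 2 := by rw [hJ, hJv, sq]
    have hval : v.intValuation (ℓ : 𝓞 (realField R)) = WithZero.exp (-(2 : ℕ) : ℤ) := by
      refine intValuation_eq_exp_neg_of_mem_of_notMem v 2 ?_ ?_
      · rw [← hsq]; exact Ideal.mem_span_singleton_self _
      · intro h3
        have hdvd : v.asIdeal ^ 3 ∣ v.asIdeal ^ 2 := by
          rw [← hsq]; exact Ideal.dvd_iff_le.2 ((Ideal.span_singleton_le_iff_mem _).2 h3)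
        have := (pow_dvd_pow_iff v.ne_bot hunit).1 hdvd
        omega
    rw [hord] at hval
    have := WithZero.exp_injective hval
    omega
  obtain ⟨hprod, -⟩ := span_natCast_eq_mul_of_ne hK hℓ v v' hvv' hℓv hℓw'
  have hall : ∀ u : HeightOneSpectrum (𝓞 (realField R)), (ℓ : 𝓞 (realField R)) ∈ u.asIdeal → u = v ∨ u = v' := by
    intro u hℓu
    have hle : v.asIdeal * v'.asIdeal ≤ u.asIdeal := by
      rw [← hprod]; exact (Ideal.span_singleton_le_iff_mem _).2 hℓu
    rcases u.isPrime.mul_le.1 hle with h | h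
    · exact Or.inl (HeightOneSpectrum.ext (v.isMaximal.eq_of_le u.isPrime.ne_top h)).symm
    · exact Or.inr (HeightOneSpectrum.ext (v'.isMaximal.eq_of_le u.isPrime.ne_top h)).symm
  -- `ord_{v'} ℓ = 1`
  have hunit' : ¬ IsUnit v'.asIdeal := fun hu ↦ v'.isPrime.ne_top (Ideal.isUnit_iff.1 hu)
  have hord' : v'.intValuation (ℓ : 𝓞 (realField R)) = WithZero.exp (-1 : ℤ) := by
    have h := intValuation_eq_exp_neg_of_mem_of_notMem v' 1 (by rw [pow_one]; exact hℓw') ?_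
    · simpa using h
    · intro h2
      have hdvd : v'.asIdeal ^ 2 ∣ v.asIdeal * v'.asIdeal := by
        rw [← hprod]; exact Ideal.dvd_iff_le.2 ((Ideal.span_singleton_le_iff_mem _).2 h2)
      rw [sq] at hdvd
      have h1 : v'.asIdeal ∣ v.asIdeal := (mul_dvd_mul_iff_right v'.ne_bot).1 hdvd
      exact hvv' (HeightOneSpectrum.ext (v.isMaximal.eq_of_le v'.isPrime.ne_top (Ideal.le_of_dvd h1)))
  -- `θ ≡ -p-r (mod v')`: `x x' ∈ (ℓ) ⊆ v'`, and `x ∉ v'` (else `x ∈ v ∩ v' = (ℓ)`, `ℓ² ∣ N(x) = R(r)`)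
  have hxv' : x ∉ v'.asIdeal := by
    intro h
    have hmem : x ∈ v.asIdeal * v'.asIdeal := by
      rw [Ideal.mul_eq_inf_of_coprime (Ideal.IsMaximal.coprime_of_ne v.isMaximal v'.isMaximal
        (fun e ↦ hvv' (HeightOneSpectrum.ext e)))]
      exact ⟨hxv, h⟩
    rw [← hprod, Ideal.mem_span_singleton'] at hmem
    obtain ⟨t, ht⟩ := hmem
    have hdvd := pow_dvd_norm_of_eq_natCast_mul (K := realField R) (x' := x) (t := t) (by rw [← ht, mul_comm])
    rw [hK, hx, norm_int_root_sub_intCast hR hθ r] at hdvd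
    exact hR2 hdvd
  have hx'v' : x' ∈ v'.asIdeal := by
    have h : x * x' ∈ v'.asIdeal := by rw [hxx']; exact v'.asIdeal.mul_mem_right _ hℓw'
    exact (v'.isPrime.mem_or_mem h).resolve_left hxv'
  refine ⟨r, v, v', ⟨m₁, hm₁⟩, hvv', hℓv, hℓw', hxv, ?_, hNv, hNJ, hord, hord', hall⟩
  have e : θₒ + r + p = -x' := by rw [hx']; ring
  rw [e]; exact v'.asIdeal.neg_mem hx'v'

/-! ### §152 The square class of `θ` on the labelled fibre -/

/-- **At a place `v ∋ ℓ` of norm `ℓ` with `θ ≡ r (mod v)` (`ℓ` odd, `ℓ ∤ q`, `ord_v ℓ` odd): `v ∈ T(ℓ) ⟺ r` is a non-square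
mod `ℓ`.** [cite: Omeara1963, §63B Cor. 63:11a and Example 63:12] [cite: Deligne1982HodgeCycles, §4 (1)] -/
theorem inl_mem_badPlaces_natCast_iff_not_isSquare_of_sub_intCast_mem {p q : ℤ} (hR : R = X ^ 2 + C p * X + C q)
    {θₒ : 𝓞 (realField R)} (hθ : (θₒ : realField R) = AdjoinRoot.root (realPolyQ R)) {ℓ : ℕ} (hℓ : ℓ.Prime) (hℓ2 : ℓ ≠ 2)
    (hℓq : ¬ (ℓ : ℤ) ∣ q) (v : HeightOneSpectrum (𝓞 (realField R))) (hℓv : (ℓ : 𝓞 (realField R)) ∈ v.asIdeal)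
    (hN : Ideal.absNorm v.asIdeal = ℓ) (hord : v.intValuation (ℓ : 𝓞 (realField R)) = WithZero.exp (-1 : ℤ))
    {r : ℤ} (hr : θₒ - r ∈ v.asIdeal) :
    Sum.inl v ∈ badPlaces (ℓ : realField R) (AdjoinRoot.root (realPolyQ R)) ↔ ¬ IsSquare ((r : ℤ) : ZMod ℓ) := by
  have h2 := two_notMem_of_natCast_mem hℓ hℓ2 v hℓv
  have hθv := root_notMem_of_not_dvd hR hθ hℓ hℓq v hℓv
  have hfac : AdjoinRoot.root (realPolyQ R) = (1 : realField R) ^ 2 * (θₒ : realField R) := by rw [one_pow, one_mul, hθ]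
  rw [inl_mem_badPlaces_natCast_iff_of_notMem hfac v h2 hθv hℓ, Ideal.Quotient.eq.2 hr,
    isSquare_intCast_residue_iff_of_absNorm_eq v hℓ hN r]
  have hodd : Odd (WithZero.log (v.valuation (realField R) (ℓ : realField R))) := by
    rw [show (ℓ : realField R) = algebraMap (𝓞 (realField R)) (realField R) (ℓ : 𝓞 (realField R)) by rw [map_natCast],
      HeightOneSpectrum.valuation_of_algebraMap, hord, WithZero.log_exp]
    decide
  exact ⟨fun h ↦ h.1, fun h ↦ ⟨h, hodd⟩⟩

/-- **FIBRE CONSTANCY ⟺ `(q|ℓ) = 1`; LONELY PRIMES ⟺ `(q|ℓ) = -1`.** For the labelled fibre `v, v'` of §151 (`θ ≡ r` mod `v`,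
`θ ≡ -p-r` mod `v'`): since `r·(-p-r) ≡ q (mod ℓ)`, **`(v ∈ T(ℓ) ⟺ v' ∈ T(ℓ)) ⟺ q` is a square mod `ℓ`** (`ℓ ∤ q`).
[cite: Omeara1963, §63B Cor. 63:11a and Example 63:12] [cite: Deligne1982HodgeCycles, §4 (1)] -/
theorem inl_mem_badPlaces_natCast_iff_iff_isSquare_const {p q : ℤ} (hR : R = X ^ 2 + C p * X + C q)
    {θₒ : 𝓞 (realField R)} (hθ : (θₒ : realField R) = AdjoinRoot.root (realPolyQ R)) {ℓ : ℕ} (hℓ : ℓ.Prime) (hℓ2 : ℓ ≠ 2)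
    (hℓq : ¬ (ℓ : ℤ) ∣ q) {r : ℤ} (hrR : (ℓ : ℤ) ∣ r ^ 2 + p * r + q)
    (v v' : HeightOneSpectrum (𝓞 (realField R))) (hℓv : (ℓ : 𝓞 (realField R)) ∈ v.asIdeal)
    (hℓv' : (ℓ : 𝓞 (realField R)) ∈ v'.asIdeal) (hN : Ideal.absNorm v.asIdeal = ℓ) (hN' : Ideal.absNorm v'.asIdeal = ℓ)
    (hord : v.intValuation (ℓ : 𝓞 (realField R)) = WithZero.exp (-1 : ℤ))
    (hord' : v'.intValuation (ℓ : 𝓞 (realField R)) = WithZero.exp (-1 : ℤ))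
    (hr : θₒ - r ∈ v.asIdeal) (hr' : θₒ + r + p ∈ v'.asIdeal) :
    (Sum.inl v ∈ badPlaces (ℓ : realField R) (AdjoinRoot.root (realPolyQ R)) ↔
        Sum.inl v' ∈ badPlaces (ℓ : realField R) (AdjoinRoot.root (realPolyQ R))) ↔
      IsSquare ((q : ℤ) : ZMod ℓ) := by
  haveI := Fact.mk hℓ
  have hr'' : θₒ - ((-p - r : ℤ) : 𝓞 (realField R)) ∈ v'.asIdeal := by
    have e : θₒ - ((-p - r : ℤ) : 𝓞 (realField R)) = θₒ + r + p := by push_cast; ring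
    rw [e]; exact hr'
  rw [inl_mem_badPlaces_natCast_iff_not_isSquare_of_sub_intCast_mem hR hθ hℓ hℓ2 hℓq v hℓv hN hord hr,
    inl_mem_badPlaces_natCast_iff_not_isSquare_of_sub_intCast_mem hR hθ hℓ hℓ2 hℓq v' hℓv' hN' hord' hr'']
  -- `r · (-p-r) = q - R(r) ≡ q (mod ℓ)`
  have hprod : ((r : ℤ) : ZMod ℓ) * ((-p - r : ℤ) : ZMod ℓ) = ((q : ℤ) : ZMod ℓ) := by
    have h0 : ((r ^ 2 + p * r + q : ℤ) : ZMod ℓ) = 0 := (ZMod.intCast_zmod_eq_zero_iff_dvd _ ℓ).2 hrR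
    push_cast at h0 ⊢
    linear_combination -h0
  have hq0 : ((q : ℤ) : ZMod ℓ) ≠ 0 := fun h ↦ hℓq ((ZMod.intCast_zmod_eq_zero_iff_dvd q ℓ).1 h)
  have hr0 : ((r : ℤ) : ZMod ℓ) ≠ 0 := fun h ↦ hq0 (by rw [← hprod, h, zero_mul])
  have hr0' : ((-p - r : ℤ) : ZMod ℓ) ≠ 0 := fun h ↦ hq0 (by rw [← hprod, h, mul_zero])
  rw [← hprod, isSquare_mul_iff_isSquare_iff_zmod hr0 hr0']
  tauto

/-! ### §153 Inert primes with `(q|ℓ) = 1`: `θ` is a square mod `v` -/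

omit [Fact (Irreducible (cmPolyQ R))] in
/-- **CONVERSE OF PART 21 AT AN INERT PRIME**: `R = S² + pS + q`, `ℓ` an odd prime with `p² - 4q` a NON-square and `q` a
non-zero SQUARE mod `ℓ`, `v ∋ ℓ` (so `𝓞/v = 𝔽_{ℓ²}`): then `θ` IS a square mod `v` — Frobenius gives `θ̄^{ℓ+1} = q̄ = w²`
with `w ∈ 𝔽_ℓ`, so `θ̄^{(ℓ²-1)/2} = w^{ℓ-1} = 1` (Euler). [folklore] -/
theorem isSquare_residue_root_of_isSquare_const {p q : ℤ} (hR : R = X ^ 2 + C p * X + C q)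
    {θₒ : 𝓞 (realField R)} (hθ : (θₒ : realField R) = AdjoinRoot.root (realPolyQ R)) {ℓ : ℕ} (hℓ : ℓ.Prime) (hℓ2 : ℓ ≠ 2)
    (hdisc : ¬ IsSquare ((p ^ 2 - 4 * q : ℤ) : ZMod ℓ)) (hq : IsSquare ((q : ℤ) : ZMod ℓ)) (hℓq : ¬ (ℓ : ℤ) ∣ q)
    (v : HeightOneSpectrum (𝓞 (realField R))) (hℓv : (ℓ : 𝓞 (realField R)) ∈ v.asIdeal) :
    IsSquare (Ideal.Quotient.mk v.asIdeal θₒ) := by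
  classical
  haveI := Fact.mk hℓ
  haveI : v.asIdeal.IsPrime := v.isPrime
  haveI : Finite (𝓞 (realField R) ⧸ v.asIdeal) := v.asIdeal.finiteQuotientOfFreeOfNeBot v.ne_bot
  letI : Fintype (𝓞 (realField R) ⧸ v.asIdeal) := Fintype.ofFinite _
  haveI : v.asIdeal.IsMaximal := v.isMaximal
  letI : Field (𝓞 (realField R) ⧸ v.asIdeal) := Ideal.Quotient.field v.asIdeal
  have hN := absNorm_eq_sq_of_not_isSquare_disc hR hθ hℓ hdisc v hℓv
  have hcard : Fintype.card (𝓞 (realField R) ⧸ v.asIdeal) = ℓ ^ 2 := by rw [card_quotient_eq_absNorm, hN]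
  haveI hchar : CharP (𝓞 (realField R) ⧸ v.asIdeal) ℓ := charP_of_card_eq_prime_pow hcard
  haveI : ExpChar (𝓞 (realField R) ⧸ v.asIdeal) ℓ := ExpChar.prime hℓ
  set ψ := ZMod.castHom (dvd_refl ℓ) (𝓞 (realField R) ⧸ v.asIdeal) with hψ
  set t : 𝓞 (realField R) ⧸ v.asIdeal := Ideal.Quotient.mk v.asIdeal θₒ with ht
  have hrel := ringOfIntegers_root_rel_quadratic hR hθ
  have hrelk : t ^ 2 + (p : 𝓞 (realField R) ⧸ v.asIdeal) * t + (q : 𝓞 (realField R) ⧸ v.asIdeal) = 0 := by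
    have h := congrArg (Ideal.Quotient.mk v.asIdeal) hrel
    rwa [map_add, map_add, map_mul, map_pow, map_intCast, map_intCast, map_zero] at h
  have hnoroot : ∀ i : ZMod ℓ, i ^ 2 + (p : ZMod ℓ) * i + (q : ZMod ℓ) ≠ 0 :=
    no_root_of_disc_not_isSquare p q (by push_cast at hdisc ⊢; exact hdisc)
  have hfrob_root : (t ^ ℓ) ^ 2 + (p : 𝓞 (realField R) ⧸ v.asIdeal) * t ^ ℓ + (q : 𝓞 (realField R) ⧸ v.asIdeal) = 0 := by
    have h := congrArg (frobenius (𝓞 (realField R) ⧸ v.asIdeal) ℓ) hrelk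
    rw [map_add, map_add, map_mul, map_pow, map_intCast, map_intCast, map_zero, frobenius_def] at h
    exact h
  have hne : t ^ ℓ ≠ t := fun hfix ↦ by
    obtain ⟨i, hi⟩ := exists_zmod_cast_eq_of_pow_eq_self (K := 𝓞 (realField R) ⧸ v.asIdeal) hfix
    apply hnoroot i
    apply ψ.injective
    rw [map_add, map_add, map_mul, map_pow, map_intCast, map_intCast, map_zero, hi]
    exact hrelk
  have hconj : t ^ ℓ = -(p : 𝓞 (realField R) ⧸ v.asIdeal) - t := by
    have h0 : (t ^ ℓ - t) * (t ^ ℓ - (-(p : 𝓞 (realField R) ⧸ v.asIdeal) - t)) = 0 := by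
      linear_combination hfrob_root - hrelk
    rcases mul_eq_zero.1 h0 with h | h
    · exact absurd (sub_eq_zero.1 h) hne
    · exact sub_eq_zero.1 h
  have hnorm : t ^ (ℓ + 1) = (q : 𝓞 (realField R) ⧸ v.asIdeal) := by
    rw [pow_succ, hconj]; linear_combination (-1 : 𝓞 (realField R) ⧸ v.asIdeal) * hrelk
  -- `q̄ = ψ(w)²` with `w ∈ 𝔽_ℓ`, `w ≠ 0`
  obtain ⟨w, hw⟩ := hq
  have hqψ : (q : 𝓞 (realField R) ⧸ v.asIdeal) = ψ w * ψ w := by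
    rw [← map_mul, ← hw, map_intCast]
  have hq0 : ((q : ℤ) : ZMod ℓ) ≠ 0 := fun h ↦ hℓq ((ZMod.intCast_zmod_eq_zero_iff_dvd q ℓ).1 h)
  have hw0 : w ≠ 0 := fun h ↦ hq0 (by rw [hw, h, mul_zero])
  have ht0 : t ≠ 0 := fun h ↦ by
    have : (q : 𝓞 (realField R) ⧸ v.asIdeal) = 0 := by rw [← hnorm, h, zero_pow (by omega)]
    apply hq0
    apply ψ.injective
    rw [map_intCast, map_zero]; exact this
  -- Euler's criterion in `𝔽_{ℓ²}`: `t^{(ℓ²-1)/2} = (t^{ℓ+1})^{(ℓ-1)/2} = w^{ℓ-1} = 1`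
  have hchar2 : ringChar (𝓞 (realField R) ⧸ v.asIdeal) ≠ 2 := by rw [ringChar.eq (𝓞 (realField R) ⧸ v.asIdeal) ℓ]; exact hℓ2
  rw [FiniteField.isSquare_iff hchar2 ht0, hcard]
  have hodd : ℓ % 2 = 1 := (Nat.Prime.mod_two_eq_one_iff_ne_two hℓ).2 hℓ2
  obtain ⟨k, hk⟩ : ∃ k, ℓ = 2 * k + 1 := ⟨ℓ / 2, by omega⟩
  have hdiv : ℓ ^ 2 / 2 = (ℓ + 1) * k := by
    rw [hk]; ring_nf
    omega
  rw [hdiv, pow_mul, hnorm, hqψ, ← map_mul, ← map_pow, ← sq, ← pow_mul]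
  have hfermat : w ^ (2 * k) = 1 := by
    have h := ZMod.pow_card_sub_one_eq_one hw0
    rwa [show ℓ - 1 = 2 * k by omega] at h
  rw [hfermat, map_one]

/-- Hence **an inert place with `(q|ℓ) = 1` lies in no `T(ℓ)`**; with part 47: at the primes `ℓ` inert in `F` and prime to
`2q`, `(ℓ) ∈ T(ℓ) ⟺ (q|ℓ) = -1`. [cite: Omeara1963, §63B Example 63:12] [cite: Deligne1982HodgeCycles, §4 (1)] -/
theorem inl_mem_badPlaces_natCast_iff_of_not_isSquare_disc {p q : ℤ} (hR : R = X ^ 2 + C p * X + C q)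
    {θₒ : 𝓞 (realField R)} (hθ : (θₒ : realField R) = AdjoinRoot.root (realPolyQ R)) {ℓ : ℕ} (hℓ : ℓ.Prime) (hℓ2 : ℓ ≠ 2)
    (hdisc : ¬ IsSquare ((p ^ 2 - 4 * q : ℤ) : ZMod ℓ)) (hℓq : ¬ (ℓ : ℤ) ∣ q)
    (v : HeightOneSpectrum (𝓞 (realField R))) (hℓv : (ℓ : 𝓞 (realField R)) ∈ v.asIdeal) :
    Sum.inl v ∈ badPlaces (ℓ : realField R) (AdjoinRoot.root (realPolyQ R)) ↔ ¬ IsSquare ((q : ℤ) : ZMod ℓ) := by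
  constructor
  · intro h hq
    have h2 := two_notMem_of_natCast_mem hℓ hℓ2 v hℓv
    have hθv := root_notMem_of_not_dvd hR hθ hℓ hℓq v hℓv
    have hfac : AdjoinRoot.root (realPolyQ R) = (1 : realField R) ^ 2 * (θₒ : realField R) := by rw [one_pow, one_mul, hθ]
    exact ((inl_mem_badPlaces_natCast_iff_of_notMem hfac v h2 hθv hℓ).1 h).1
      (isSquare_residue_root_of_isSquare_const hR hθ hℓ hℓ2 hdisc hq hℓq v hℓv)
  · exact fun hq ↦ inl_mem_badPlaces_natCast_of_not_isSquare_disc_const hR hθ hℓ hℓ2 hdisc hq v hℓv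

end Summit.HodgeConjecture.HodgeConjecture.Ring2.WeilCoverageCM

end
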